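import Summits.Ventures.PercRepro2.CaseOneStarCertT1
import Summits.Ventures.PercRepro2.CaseOneGadgetUWA1BBlockII0
import Summits.Ventures.PercRepro2.CaseOneGadgetUWA1BBlockII1
import Summits.Ventures.PercRepro2.CaseOneGadgetUWA1BBlockII2
import Summits.Ventures.PercRepro2.CaseOneGadgetUWA1BBlockII3
import Summits.Ventures.PercRepro2.CaseOneGadgetUWA1BBlockII4
import Summits.Ventures.PercRepro2.CaseOneGadgetUWA1BBlockII5
import Summits.Ventures.PercRepro2.CaseOneGadgetUWA1BBlockII6
import Summits.Ventures.PercRepro2.CaseOneGadgetUWA1BBlockII7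
import Summits.Ventures.PercRepro2.CaseOneGadgetUWA1BBlockII8
import Summits.Ventures.PercRepro2.CaseOneGadgetUWA1BBlockII9
import Summits.Ventures.PercRepro2.CaseOneGadgetUWA1BBlockII10
import Summits.Ventures.PercRepro2.CaseOneGadgetUWA1BBlockII11
import Summits.Ventures.PercRepro2.CaseOneGadgetUWA1BBlockII12
import Summits.Ventures.PercRepro2.CaseOneGadgetUWA1BBlockII13
import Summits.Ventures.PercRepro2.CaseOneGadgetUWA1BBlockII14
import Summits.Ventures.PercRepro2.CaseOneStarFactsB

/-!
# The gadget `u ~ {w, a₁, b}`, `w ~ {u, a₂, o}` (uwa1b): the cell certificates of `iiAB5` (part 34g)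
(blind cell PercRepro2, p1 g34; the fourth gadget anchor of the six-form calculus — all six forms of the uwa1b gadget
as plain SFacts-cone certificate chains, generated by mining/p1/g34/uwa1b/genu.py = p1 g33's gent_uwa1.py / g25's
geno.py re-targeted; P1-G33 §6–§6″, P1-G34)

Each `eBABII ijk kl` is a nonnegative combination of `(pairwise atom) × (cell)` and cubic cell monomials — or, for the degree-4 ones, `M × eBABII ijk kl` (`M = Σ cᵢ` the total cell mass) is a nonnegative combination of `(atom) × (cell) × (cell)` and quartic cell monomials, then `SFacts.nonneg_of_sum_mul` (`CaseOneStarCertT1`) — exact LP certificates (kit j318477, every certificate re-verified exactly; data/p1/g33/gcerts_ii_uwa1b.json, form `ii`), here as exact `linear_combination`s over `SFacts` (the rational coefficients cleared by their common denominator). -/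

namespace Summit.Ventures.PercRepro2

namespace CaseOne

section CertABII34g
variable {R : Type*} [Field R] [LinearOrder R] [IsStrictOrderedRing R]

set_option maxHeartbeats 0 in
/-- `eBABII23303 ≥ 0`: the combination is identically zero (`ring`). -/
lemma eBABII23303_nonneg (m : SCells R) (_hf : SFactsB m) : 0 ≤ eBABII23303 m := by
  have h : eBABII23303 m = 0 := by
    unfold eBABII23303 cBABII00103 cBABII00203 cBABII01003 cBABII01103 cBABII01203 cBABII01303 cBABII02003 cBABII02103 cBABII02203 cBABII02303 cBABII03103 cBABII03203 cBABII03303 cBABII10003 cBABII10103 cBABII10203 cBABII10303 cBABII11003 cBABII11103 cBABII11203 cBABII11303 cBABII12003 cBABII12103 cBABII12203 cBABII12303 cBABII13003 cBABII13103 cBABII13203 cBABII13303 cBABII20003 cBABII20103 cBABII20203 cBABII20303 cBABII21003 cBABII21103 cBABII21203 cBABII21303 cBABII22003 cBABII22103 cBABII22203 cBABII22303 cBABII23003 cBABII23103 cBABII23203 cBABII23303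
    ring
  linarith [h]

set_option maxHeartbeats 0 in
/-- `eBABII23310 ≥ 0`: the combination is identically zero (`ring`). -/
lemma eBABII23310_nonneg (m : SCells R) (_hf : SFactsB m) : 0 ≤ eBABII23310 m := by
  have h : eBABII23310 m = 0 := by
    unfold eBABII23310 cBABII00110 cBABII00210 cBABII01010 cBABII01110 cBABII01210 cBABII01310 cBABII02010 cBABII02110 cBABII02210 cBABII02310 cBABII03110 cBABII03210 cBABII03310 cBABII10110 cBABII10210 cBABII10310 cBABII11010 cBABII11110 cBABII11210 cBABII11310 cBABII12010 cBABII12110 cBABII12210 cBABII12310 cBABII13010 cBABII13110 cBABII13210 cBABII13310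
    ring
  linarith [h]

end CertABII34g

end CaseOne

end Summit.Ventures.PercRepro2
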